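import Literature.Geometry.Lorentzian.KerrBoyerLindquistExtrinsic
import Literature.Geometry.Lorentzian.KerrBoyerLindquistLeafInjective
import Literature.Geometry.Lorentzian.KerrBoyerLindquistDecay
import Literature.Geometry.Lorentzian.ExactKerrEnd
import Literature.Geometry.Lorentzian.ModelData
import HarnessLib

/-!
# The Boyer–Lindquist slice of Kerr as an initial data set with an exact Kerr end

The **rest-frame Kerr data in quasi-isotropic Cartesian coordinates**: on the slice
`Kerr.slice 0 ρ₁ = {‖y‖ > max ρ₁ 0}` (`ρ₁ ≥ ρH`, `0 ≤ M`, arbitrary spin `a`) the initial data set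
`Kerr.BL.blData` with metric the closed form `blHRepCLM` of the Boyer–Lindquist slice metric
(`h = (Σ/ρ²)δ + (a²(Σ + 2MR)/Σ) ϖ ⊗ ϖ`, `KerrBoyerLindquistDecay.lean`) and second fundamental form
the closed form `kRepCLM` (`KerrBoyerLindquistExtrinsicForm.lean`). By the leaf theorems of the
series (`isSpacelikeImmersion_leaf`, `leaf_injective`, `isFutureUnitNormal_normal`,
`bilin_mfderiv_leaf`, `secondFundamentalForm_leaf`) these data ARE the data induced on the
Boyer–Lindquist slice `{t = 0}` of Kerr by the ingoing Kerr–Schild chart, so they carry an exact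
Kerr end with EMPTY exceptional set (`isExactKerrEndAlong_blData`, `hasExactKerrEnd_blData`) — the
first exact Kerr end with `a ≠ 0` and Dafermos–Rodnianski-admissible asymptotics in the tree
(the metric decay is `isBigOSmooth_blHRepCLM_sub`; the decay of `k` and the packaging of the
admissibility are the business of the sequel).

References: Brandt–Seidel, Phys. Rev. D 54 (1996) 1403, §II; Corvino–Schoen, J. Diff. Geom. 73
(2006), §1 and Thm. 4 (data exactly Kerr outside a compact set); Bartnik–Isenberg 2004, §2.
-/

noncomputable section

-- instance search through the nested operator types `E3 →L[ℝ] E3 →L[ℝ] ℝ`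
set_option maxSynthPendingDepth 3

open Bundle TopologicalSpace Set Module Real Filter Function
open scoped InnerProductSpace Topology ContDiff Manifold

namespace Literature.Geometry.Lorentzian

namespace Kerr.BL

open Kerr.Ingoing InitialDataSet

variable {M a b ρ₁ : ℝ}

/-! ### Smoothness of the metric closed form -/

/-- Differences of `C^n` vector functions are `C^n` (general normed target). [folklore] -/
theorem contDiffAt_sub' {V F : Type*} [NormedAddCommGroup V] [NormedSpace ℝ V]
    [NormedAddCommGroup F] [NormedSpace ℝ F] {f g : V → F} {y : V} {n : WithTop ℕ∞}
    (hf : ContDiffAt ℝ n f y) (hg : ContDiffAt ℝ n g y) : ContDiffAt ℝ n (fun y ↦ f y - g y) y :=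
  hf.sub hg

/-- The coefficients `yᵢyⱼ/‖y‖⁴` are smooth off the origin. [folklore] -/
theorem contDiffAt_apply_mul_apply_div {y : E3} (hy : y ≠ 0) (i j : Fin 3) :
    ContDiffAt ℝ ∞ (fun y : E3 ↦ y i * y j / ‖y‖ ^ 4) y :=
  (((EuclideanSpace.proj (𝕜 := ℝ) i).contDiff.contDiffAt).mul
    ((EuclideanSpace.proj (𝕜 := ℝ) j).contDiff.contDiffAt)).div ((contDiffAt_norm ℝ hy).pow 4)
    (pow_ne_zero 4 (norm_ne_zero_iff.2 hy))

/-- The axial tensor `ϖ ⊗ ϖ` is smooth off the origin. [cite: BrandtSeidel1996, §II] -/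
theorem contDiffAt_rotTensor {y : E3} (hy : y ≠ 0) : ContDiffAt ℝ ∞ (fun y : E3 ↦ rotTensor y) y := by
  unfold rotTensor
  exact contDiffAt_add' (F := E3 →L[ℝ] E3 →L[ℝ] ℝ)
    (contDiffAt_sub' (F := E3 →L[ℝ] E3 →L[ℝ] ℝ)
      (contDiffAt_sub' (F := E3 →L[ℝ] E3 →L[ℝ] ℝ)
        (contDiffAt_smul' (F := E3 →L[ℝ] E3 →L[ℝ] ℝ) (contDiffAt_apply_mul_apply_div hy 0 0)
          contDiffAt_const)
        (contDiffAt_smul' (F := E3 →L[ℝ] E3 →L[ℝ] ℝ) (contDiffAt_apply_mul_apply_div hy 0 1)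
          contDiffAt_const))
      (contDiffAt_smul' (F := E3 →L[ℝ] E3 →L[ℝ] ℝ) (contDiffAt_apply_mul_apply_div hy 1 0)
        contDiffAt_const))
    (contDiffAt_smul' (F := E3 →L[ℝ] E3 →L[ℝ] ℝ) (contDiffAt_apply_mul_apply_div hy 1 1)
      contDiffAt_const)

/-- **The metric closed form is smooth beyond the threshold** (`0 ≤ M`; `Σ > 0` there).
[cite: BrandtSeidel1996, §II] -/
theorem contDiffAt_blHRepCLM (hM : 0 ≤ M) {y : E3} (hy : rhoH M a < ‖y‖) :
    ContDiffAt ℝ ∞ (blHRepCLM M a) y := by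
  have hy0 : y ≠ 0 := by
    intro h0; rw [h0, norm_zero] at hy; exact absurd hy (not_lt.2 (rhoH_nonneg M a))
  have hρ : ‖y‖ ≠ 0 := norm_ne_zero_iff.2 hy0
  have hn : ContDiffAt ℝ ∞ (fun y : E3 ↦ ‖y‖) y := contDiffAt_norm ℝ hy0
  have hR := contDiffAt_qiRadius_norm M a hy0 (n := ∞)
  have hS : ContDiffAt ℝ ∞ (fun y : E3 ↦ qiRadius M a ‖y‖ ^ 2 + a ^ 2 * (y 2 / ‖y‖) ^ 2) y :=
    contDiffAt_sigmaE (M := M) (a := a) hy0 (n := ∞)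
  have hS0 : qiRadius M a ‖y‖ ^ 2 + a ^ 2 * (y 2 / ‖y‖) ^ 2 ≠ 0 := (sigmaE_pos hM hy).ne'
  unfold blHRepCLM
  exact contDiffAt_add' (F := E3 →L[ℝ] E3 →L[ℝ] ℝ)
    (contDiffAt_smul' (F := E3 →L[ℝ] E3 →L[ℝ] ℝ) (hS.div (hn.pow 2) (pow_ne_zero 2 hρ))
      contDiffAt_const)
    (contDiffAt_smul' (F := E3 →L[ℝ] E3 →L[ℝ] ℝ)
      ((contDiffAt_const.mul (hS.add ((contDiffAt_const.mul hR)))).div hS hS0)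
      (contDiffAt_rotTensor hy0))

/-! ### The metric of the data -/

variable (M a ρ₁) in
/-- The metric of the Boyer–Lindquist data at `y`: the closed form `blHRepCLM M a y` on
`T_y = E3`. [cite: BrandtSeidel1996, §II] -/
def blInner (y : slice 0 ρ₁) :
    TangentSpace 𝓘(ℝ, E3) y →L[ℝ] TangentSpace 𝓘(ℝ, E3) y →L[ℝ] ℝ :=
  blHRepCLM M a y

/-- `h_y(v, w) = blHRep y (v, w)`. [cite: BrandtSeidel1996, §II] -/
@[simp]
theorem blInner_apply (y : slice 0 ρ₁) (v w : TangentSpace 𝓘(ℝ, E3) y) :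
    blInner M a ρ₁ y v w = blHRep M a y v w :=
  blHRepCLM_apply M a y v w

/-- `h` is symmetric. [cite: BrandtSeidel1996, §II] -/
theorem blInner_symm (y : slice 0 ρ₁) (v w : TangentSpace 𝓘(ℝ, E3) y) :
    blInner M a ρ₁ y v w = blInner M a ρ₁ y w v := by
  rw [blInner_apply, blInner_apply, blHRep_symm]

/-- `h` is positive definite (`0 ≤ M`, `ρ₁ ≥ ρH`). [cite: BrandtSeidel1996, §II] -/
theorem blInner_pos (hM : 0 ≤ M) (hρ₁ : rhoH M a ≤ ρ₁) (y : slice 0 ρ₁)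
    (v : TangentSpace 𝓘(ℝ, E3) y) (hv : v ≠ 0) : 0 < blInner M a ρ₁ y v v := by
  rw [blInner_apply]
  exact blHRep_pos hM (rhoH_lt_norm hρ₁ y) hv

/-- The lower bound `h(v, v) ≥ (Σ/ρ²)‖v‖²` (`0 ≤ M`). [cite: BrandtSeidel1996, §II] -/
theorem blHRep_self_ge (hM : 0 ≤ M) {x : E3} (hx : rhoH M a < ‖x‖) (v : E3) :
    (qiRadius M a ‖x‖ ^ 2 + a ^ 2 * (x 2 / ‖x‖) ^ 2) / ‖x‖ ^ 2 * ‖v‖ ^ 2 ≤ blHRep M a x v v := by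
  have hR : 0 < qiRadius M a ‖x‖ := qiRadius_pos_of_rhoH_lt hM hx
  have hS : 0 < qiRadius M a ‖x‖ ^ 2 + a ^ 2 * (x 2 / ‖x‖) ^ 2 := by positivity
  unfold blHRep
  rw [real_inner_self_eq_norm_sq]
  have h2 : 0 ≤ a ^ 2 * (qiRadius M a ‖x‖ ^ 2 + a ^ 2 * (x 2 / ‖x‖) ^ 2 + 2 * M * qiRadius M a ‖x‖) /
      (qiRadius M a ‖x‖ ^ 2 + a ^ 2 * (x 2 / ‖x‖) ^ 2) * (rotForm x v * rotForm x v) := by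
    have : 0 ≤ rotForm x v * rotForm x v := mul_self_nonneg _
    positivity
  linarith

/-- The unit ball of `h_y` is von Neumann bounded (it lies in a Euclidean ball, by the lower bound
`h(v, v) ≥ (Σ/ρ²)‖v‖²`). [cite: BrandtSeidel1996, §II] -/
theorem isVonNBounded_blInner (hM : 0 ≤ M) (hρ₁ : rhoH M a ≤ ρ₁) (y : slice 0 ρ₁) :
    Bornology.IsVonNBounded ℝ {v : TangentSpace 𝓘(ℝ, E3) y | blInner M a ρ₁ y v v < 1} := by
  have hy : rhoH M a < ‖(y : E3)‖ := rhoH_lt_norm hρ₁ y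
  have hy0 : (y : E3) ≠ 0 := ne_zero_of_mem_slice_zero y
  have hR : 0 < qiRadius M a ‖(y : E3)‖ := qiRadius_pos_of_rhoH_lt hM hy
  set c : ℝ := (qiRadius M a ‖(y : E3)‖ ^ 2 + a ^ 2 * ((y : E3) 2 / ‖(y : E3)‖) ^ 2) /
    ‖(y : E3)‖ ^ 2 with hc
  have hc0 : 0 < c := by
    have : 0 < ‖(y : E3)‖ := norm_pos_iff.2 hy0
    positivity
  refine (NormedSpace.isVonNBounded_ball ℝ E3 (Real.sqrt (1 / c))).subset fun v hv ↦ ?_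
  set w : E3 := v with hw
  change blHRepCLM M a y w w < 1 at hv
  rw [blHRepCLM_apply] at hv
  have hle := blHRep_self_ge hM hy w
  rw [← hc] at hle
  have hsq : ‖w‖ ^ 2 < 1 / c := by
    rw [lt_div_iff₀ hc0]
    nlinarith
  change w ∈ Metric.ball (0 : E3) (Real.sqrt (1 / c))
  rw [mem_ball_zero_iff]
  calc ‖w‖ = Real.sqrt (‖w‖ ^ 2) := (Real.sqrt_sq (norm_nonneg _)).symm
    _ < Real.sqrt (1 / c) := Real.sqrt_lt_sqrt (sq_nonneg _) hsq

/-- The section `y ↦ h_y` is smooth (`0 ≤ M`, `ρ₁ ≥ ρH`). [cite: BrandtSeidel1996, §II] -/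
theorem contMDiff_blInner (hM : 0 ≤ M) (hρ₁ : rhoH M a ≤ ρ₁) :
    ContMDiff 𝓘(ℝ, E3) (𝓘(ℝ, E3).prod 𝓘(ℝ, E3 →L[ℝ] E3 →L[ℝ] ℝ)) ∞
      (fun y : slice 0 ρ₁ ↦ TotalSpace.mk' (E3 →L[ℝ] E3 →L[ℝ] ℝ)
        (E := fun x : slice 0 ρ₁ ↦ TangentSpace 𝓘(ℝ, E3) x →L[ℝ] TangentSpace 𝓘(ℝ, E3) x →L[ℝ] ℝ)
        y (blInner M a ρ₁ y)) := by
  refine OpensSection.contMDiff_bilinSection (slice 0 ρ₁) (fun y ↦ blInner M a ρ₁ y) ?_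
  have h : ContDiffOn ℝ ∞ (blHRepCLM M a) (slice 0 ρ₁ : Set E3) := fun y hy ↦
    (contDiffAt_blHRepCLM hM (rhoH_lt_norm hρ₁ ⟨y, hy⟩)).contDiffWithinAt
  exact h.contMDiffOn.comp_contMDiff contMDiff_subtype_val fun y ↦ y.2

/-- **The Boyer–Lindquist slice metric as a smooth Riemannian metric** on `Kerr.slice 0 ρ₁`
(`0 ≤ M`, `ρ₁ ≥ ρH`). Brandt–Seidel 1996, §II. [cite: BrandtSeidel1996, §II] -/
def blMetric (hM : 0 ≤ M) (hρ₁ : rhoH M a ≤ ρ₁) :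
    ContMDiffRiemannianMetric 𝓘(ℝ, E3) ∞ E3 (TangentSpace 𝓘(ℝ, E3) : slice 0 ρ₁ → Type _) where
  inner := blInner M a ρ₁
  symm := blInner_symm
  pos := blInner_pos hM hρ₁
  isVonNBounded := isVonNBounded_blInner hM hρ₁
  contMDiff := contMDiff_blInner hM hρ₁

/-! ### The data -/

/-- The section `y ↦ k_y` is smooth (`0 ≤ M`, `ρ₁ ≥ ρH`). [cite: BrandtSeidel1996, §II] -/
theorem contMDiff_kRepCLM (hM : 0 ≤ M) (hρ₁ : rhoH M a ≤ ρ₁) :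
    ContMDiff 𝓘(ℝ, E3) (𝓘(ℝ, E3).prod 𝓘(ℝ, E3 →L[ℝ] E3 →L[ℝ] ℝ)) ∞
      (fun y : slice 0 ρ₁ ↦ TotalSpace.mk' (E3 →L[ℝ] E3 →L[ℝ] ℝ)
        (E := fun x : slice 0 ρ₁ ↦ TangentSpace 𝓘(ℝ, E3) x →L[ℝ] TangentSpace 𝓘(ℝ, E3) x →L[ℝ] ℝ)
        y (show TangentSpace 𝓘(ℝ, E3) y →L[ℝ] TangentSpace 𝓘(ℝ, E3) y →L[ℝ] ℝ from kRepCLM M a y)) := by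
  refine OpensSection.contMDiff_bilinSection (slice 0 ρ₁) (fun y ↦ kRepCLM M a y) ?_
  have h : ContDiffOn ℝ ∞ (kRepCLM M a) (slice 0 ρ₁ : Set E3) := fun y hy ↦
    (contDiffAt_kRepCLM hM (rhoH_lt_norm hρ₁ ⟨y, hy⟩)).contDiffWithinAt
  exact h.contMDiffOn.comp_contMDiff contMDiff_subtype_val fun y ↦ y.2

/-- **The Boyer–Lindquist (rest-frame) Kerr data in quasi-isotropic Cartesian coordinates**
`(Kerr.slice 0 ρ₁, h = blHRepCLM, k = kRepCLM)`, mass `M ≥ 0`, spin `a`, `ρ₁ ≥ ρH`: the data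
induced on the slice `{t = 0}` of Kerr, written in the quasi-isotropic Cartesian coordinates of
Brandt–Seidel. Brandt–Seidel, Phys. Rev. D 54 (1996) 1403, §II; Bartnik–Isenberg 2004, §2.
[cite: BrandtSeidel1996, §II] -/
def blData (hM : 0 ≤ M) (hρ₁ : rhoH M a ≤ ρ₁) : InitialDataSet 𝓘(ℝ, E3) (slice 0 ρ₁) where
  h := blMetric hM hρ₁
  k y := kRepCLM M a y
  k_symm y v w := kRepCLM_symm (y : E3) v w
  contMDiff_k := contMDiff_kRepCLM hM hρ₁

/-- The metric of the data at `y` is `blHRepCLM M a y`. [cite: BrandtSeidel1996, §II] -/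
@[simp]
theorem blData_h_inner (hM : 0 ≤ M) (hρ₁ : rhoH M a ≤ ρ₁) (y : slice 0 ρ₁) :
    (blData hM hρ₁).h.inner y = blInner M a ρ₁ y := rfl

/-- The tensor `k` of the data at `y` is `kRepCLM M a y`. [cite: BrandtSeidel1996, §II] -/
@[simp]
theorem blData_k (hM : 0 ≤ M) (hρ₁ : rhoH M a ≤ ρ₁) (y : slice 0 ρ₁) :
    (blData hM hρ₁).k y = kRepCLM M a y := rfl

/-! ### The exact Kerr end -/

/-- **The Boyer–Lindquist data are an exact spacelike Kerr leaf EVERYWHERE** (empty exceptional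
set): with `φ = id`, `ψ = Kerr.BL.leaf M a b ρ₁`, `ν = Kerr.BL.normal`, all clauses of
`IsExactKerrEndAlong` hold — `ψ` is an injective spacelike immersion with future unit normal `ν`,
`h(v, w) = g(dψ v, dψ w)` (`bilin_mfderiv_leaf`) and `k(v, w) = K_ν(ψ)(v, w)`
(`secondFundamentalForm_leaf`). Corvino–Schoen 2006, §1; Brandt–Seidel 1996, §II.
[cite: CorvinoSchoen2006, §1 and Thm. 4] -/
theorem isExactKerrEndAlong_blData [Kerr.Facts] (hM : 0 ≤ M) (hρ₁ : rhoH M a ≤ ρ₁) (hb : rH M a < b) :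
    (blData hM hρ₁).IsExactKerrEndAlong ∅ (slice 0 ρ₁) M a 0 hM id (leaf M a b ρ₁ hM hρ₁)
      (normal M a b ρ₁ hM hρ₁) := by
  refine ⟨isCompact_empty, fun z _ ↦ ⟨z, rfl⟩, Topology.IsOpenEmbedding.id, contMDiff_id,
    leaf_injective hM hρ₁, isSpacelikeImmersion_leaf hM hρ₁ hb, isFutureUnitNormal_normal hM hρ₁ hb,
    fun z v w _ ↦ ?_, fun z v w _ ↦ ?_⟩
  · rw [mfderiv_id]
    show blHRepCLM M a z v w = _
    rw [blHRepCLM_apply]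
    exact (bilin_mfderiv_leaf hM hρ₁ hb z v w).symm
  · rw [mfderiv_id]
    show kRepCLM M a z v w = _
    exact (secondFundamentalForm_leaf hM hρ₁ hb z v w).symm

/-- **The Boyer–Lindquist Kerr data are Kerr-ended** (`HasExactKerrEnd`, empty exceptional set),
for every `M ≥ 0`, every spin `a` and every `ρ₁ ≥ ρH` — the first Kerr-ended data with `a ≠ 0` and
Dafermos–Rodnianski-admissible asymptotics in the tree. Corvino–Schoen 2006, §1 and Thm. 4;
Brandt–Seidel 1996, §II. [cite: CorvinoSchoen2006, §1 and Thm. 4] -/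
theorem hasExactKerrEnd_blData (hM : 0 ≤ M) (hρ₁ : rhoH M a ≤ ρ₁) : (blData hM hρ₁).HasExactKerrEnd := by
  intro _
  exact ⟨∅, slice 0 ρ₁, M, a, 0, hM, id, leaf M a (rH M a + 1) ρ₁ hM hρ₁,
    normal M a (rH M a + 1) ρ₁ hM hρ₁, isExactKerrEndAlong_blData hM hρ₁ (by linarith)⟩

end Kerr.BL

end Literature.Geometry.Lorentzian

end
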